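import Summits.AnomalousDissipation.AnomalousDissipation.Theorems.SoloBlindSweptStates
import Literature.Analysis.FluidPDE.SteadyGalerkinApprox

/-!
# Swept screening for every unidirectional force (solo soloist, blind mode)

`SoloBlindSweptScreening` — energies, dissipation rates and momenta of the swept steady states
`U_{ν,c}` of `SoloBlindSweptStates` (any unidirectional divergence-free trigonometric-polynomial
force `f = realTrigPoly S C`, `S ⊂ ℤk₀ ∖ 0`, any momentum `c`), and the separating Leray–Hopf
families they provide for the summit `AnomalousDissipation` (= `Literature.Turb.ZerothLaw`).

**Formulas** (`integral_norm_sq_sweptState`, `dissipation_sweptState`, `integral_sweptState`):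
`∫‖U_{ν,c}‖² = ‖c‖² + Σ_{k∈S} ‖f̂(k)‖²/|σ(k)|²`, `ν‖∇U_{ν,c}‖² = 4π²ν Σ_{k∈S} |k|²‖f̂(k)‖²/|σ(k)|²`,
`∫U_{ν,c} = c`, with the swept symbol `σ(k) = 4π²ν|k|² + 2πi (c·k)`.

**Non-resonant momentum screens the force at every viscosity.** If `c·k₀ ≠ 0` then
`|σ(k)|² ≥ 4π²(c·k₀)²` and `|k|²·4π²(c·k₀)² ≤ |k₀|²|σ(k)|²` on `S`, uniformly in `ν`
(`norm_sq_sweptSymbol_ge`), whence (`integral_norm_sq_sweptState_le`, `dissipation_sweptState_le`)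
`∫‖U_{ν,c}‖² ≤ ‖c‖² + ‖f‖₂²/(4π²(c·k₀)²)` and `ν‖∇U_{ν,c}‖² ≤ ν · |k₀|²‖f‖₂²/(c·k₀)²`.

**The separating families** (`exists_sweptFamily`): for EVERY such force and EVERY momentum `c`
with `c·k₀ ≠ 0`, the swept states at `νⱼ = 1/(j+1) → 0` are global Leray–Hopf solutions of
`NS_{νⱼ}(f)` of momentum `c` whose mean energies are bounded uniformly in `j` while their mean
dissipation rates are `≤ K νⱼ → 0`: every clause of `Literature.Turb.ZerothLaw` except the
dissipation floor holds, on every non-resonant momentum leaf, for the whole unidirectional class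
(the Kolmogorov case is `exists_boundedEnergy_vanishingDissipation`). Consequently no a-priori
argument whose hypotheses are shared by these exact solutions (bounded energy, the equations, the
energy inequality) can produce the floor for a shear-type force; a proof must use the momentum
constraint or a selection principle excluding the swept branch.
[cite: Frisch1995, §5.2] [cite: DoeringFoias2002, §2]
-/

open MeasureTheory Filter Topology Set UnitAddTorus
open scoped ENNReal NNReal ComplexConjugate InnerProductSpace

noncomputable section

namespace Summit.AnomalousDissipation.AnomalousDissipation.Theorems

open Literature.Analysis.FunctionSpaces Literature.Analysis.FunctionSpaces.Torus
open Literature.Analysis.FluidPDE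

/-! ### Energy, dissipation, momentum -/

/-- `insert 0 S` is symmetric if `S` is. [folklore] -/
theorem insert_zero_symm {S : Finset (Fin 3 → ℤ)} (hS : ∀ k ∈ S, -k ∈ S) :
    ∀ k ∈ insert (0 : Fin 3 → ℤ) S, -k ∈ insert (0 : Fin 3 → ℤ) S := by
  intro k hk
  rcases Finset.mem_insert.1 hk with rfl | hk
  · simp
  · exact Finset.mem_insert_of_mem (hS k hk)

/-- **Energy of a swept state**: `∫‖U_{ν,c}‖² = ‖c‖² + Σ_{k∈S} ‖f̂(k)‖² / |σ(k)|²`. [folklore] -/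
theorem integral_norm_sq_sweptState (ν : ℝ) (c : EuclideanSpace ℝ (Fin 3)) {S : Finset (Fin 3 → ℤ)}
    (hS : ∀ k ∈ S, -k ∈ S) (h0 : (0 : Fin 3 → ℤ) ∉ S)
    {C : (Fin 3 → ℤ) → EuclideanSpace ℂ (Fin 3)} (hC : IsConjSymm C) :
    ∫ x, ‖sweptState ν c S C x‖ ^ 2 =
      ‖c‖ ^ 2 + ∑ k ∈ S, ‖C k‖ ^ 2 / ‖sweptSymbol ν c k‖ ^ 2 := by
  rw [sweptState,
    integral_norm_sq_realTrigPoly (insert_zero_symm hS) (isConjSymm_sweptCoeff ν c hC),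
    Finset.sum_insert h0, sweptCoeff_zero, EuclideanSpace.norm_complexify]
  congr 1
  refine Finset.sum_congr rfl fun k hk => ?_
  rw [sweptCoeff_of_ne_zero ν c C (fun h => h0 (h ▸ hk)), norm_smul, norm_inv, mul_pow, inv_pow,
    div_eq_inv_mul]

/-- **Dissipation of a swept state**: `ν‖∇U_{ν,c}‖² = 4π²ν Σ_{k∈S} |k|² ‖f̂(k)‖² / |σ(k)|²`.
[folklore] -/
theorem dissipation_sweptState (ν : ℝ) (c : EuclideanSpace ℝ (Fin 3)) {S : Finset (Fin 3 → ℤ)}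
    (hS : ∀ k ∈ S, -k ∈ S) (h0 : (0 : Fin 3 → ℤ) ∉ S)
    {C : (Fin 3 → ℤ) → EuclideanSpace ℂ (Fin 3)} (hC : IsConjSymm C) :
    ν * (eGradNormSq (sweptState ν c S C)).toReal =
      4 * Real.pi ^ 2 * ν * ∑ k ∈ S, freqNormSq k * ‖C k‖ ^ 2 / ‖sweptSymbol ν c k‖ ^ 2 := by
  rw [sweptState,
    toReal_eGradNormSq_realTrigPoly (insert_zero_symm hS) (isConjSymm_sweptCoeff ν c hC),
    Finset.sum_insert h0, freqNormSq_zero, zero_mul, zero_add, ← mul_assoc, mul_comm ν]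
  congr 1
  refine Finset.sum_congr rfl fun k hk => ?_
  rw [sweptCoeff_of_ne_zero ν c C (fun h => h0 (h ▸ hk)), norm_smul, norm_inv, mul_pow, inv_pow,
    mul_div_assoc, div_eq_inv_mul]

/-- On a line of modes with non-resonant momentum the swept symbol is bounded below uniformly in
`ν`: `|σ(k)|² ≥ 4π²(c·k₀)²` for `k ∈ S ⊂ ℤk₀ ∖ 0`. [folklore] -/
theorem norm_sq_sweptSymbol_ge {ν : ℝ} {c : EuclideanSpace ℝ (Fin 3)} {S : Finset (Fin 3 → ℤ)}
    {k₀ : Fin 3 → ℤ} {n : (Fin 3 → ℤ) → ℤ} (h0 : (0 : Fin 3 → ℤ) ∉ S)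
    (hn : ∀ k ∈ S, k = n k • k₀) {k : Fin 3 → ℤ} (hk : k ∈ S) :
    (2 * Real.pi * freqDot c k₀) ^ 2 ≤ ‖sweptSymbol ν c k‖ ^ 2 ∧
      freqNormSq k * (2 * Real.pi * freqDot c k₀) ^ 2 ≤
        freqNormSq k₀ * ‖sweptSymbol ν c k‖ ^ 2 := by
  have hnk : (1 : ℝ) ≤ (n k : ℝ) ^ 2 := by
    have h : n k ≠ 0 := fun h => h0 (by rw [hn k hk, h, zero_smul] at hk; exact hk)
    have : (1 : ℤ) ≤ (n k) ^ 2 := by nlinarith [sq_pos_of_ne_zero h]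
    exact_mod_cast this
  have hdot : freqDot c k = n k * freqDot c k₀ := by
    conv_lhs => rw [hn k hk, freqDot_zsmul]
  have hnorm : freqNormSq k = (n k : ℝ) ^ 2 * freqNormSq k₀ := by
    conv_lhs => rw [hn k hk, freqNormSq_zsmul]
  rw [norm_sq_sweptSymbol, hdot, hnorm]
  constructor
  · nlinarith [sq_nonneg (4 * Real.pi ^ 2 * ν * ((n k : ℝ) ^ 2 * freqNormSq k₀)),
      sq_nonneg (2 * Real.pi * freqDot c k₀)]
  · nlinarith [sq_nonneg (4 * Real.pi ^ 2 * ν * ((n k : ℝ) ^ 2 * freqNormSq k₀)),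
      freqNormSq_nonneg k₀, sq_nonneg (n k : ℝ)]

/-- **Energy bound, uniform in the viscosity**: `∫‖U_{ν,c}‖² ≤ ‖c‖² + ‖f‖₂² / (4π²(c·k₀)²)` for
every `ν` when `c·k₀ ≠ 0`. [folklore] -/
theorem integral_norm_sq_sweptState_le (ν : ℝ) {c : EuclideanSpace ℝ (Fin 3)}
    {S : Finset (Fin 3 → ℤ)} (hS : ∀ k ∈ S, -k ∈ S) (h0 : (0 : Fin 3 → ℤ) ∉ S)
    {C : (Fin 3 → ℤ) → EuclideanSpace ℂ (Fin 3)} (hC : IsConjSymm C) {k₀ : Fin 3 → ℤ}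
    {n : (Fin 3 → ℤ) → ℤ} (hn : ∀ k ∈ S, k = n k • k₀) (hck : freqDot c k₀ ≠ 0) :
    ∫ x, ‖sweptState ν c S C x‖ ^ 2 ≤
      ‖c‖ ^ 2 + (∫ x, ‖realTrigPoly S C x‖ ^ 2) / (2 * Real.pi * freqDot c k₀) ^ 2 := by
  rw [integral_norm_sq_sweptState ν c hS h0 hC, integral_norm_sq_realTrigPoly hS hC, Finset.sum_div]
  refine add_le_add le_rfl (Finset.sum_le_sum fun k hk => ?_)
  have hpos : 0 < (2 * Real.pi * freqDot c k₀) ^ 2 := by positivity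
  have h1 := (norm_sq_sweptSymbol_ge (ν := ν) (c := c) h0 hn hk).1
  rw [div_le_div_iff₀ (lt_of_lt_of_le hpos h1) hpos]
  nlinarith [mul_le_mul_of_nonneg_left h1 (sq_nonneg ‖C k‖)]

/-- **Dissipation bound, linear in the viscosity**: `ν‖∇U_{ν,c}‖² ≤ ν · |k₀|² ‖f‖₂² / (c·k₀)²`
for `ν ≥ 0` when `c·k₀ ≠ 0`. [folklore] -/
theorem dissipation_sweptState_le {ν : ℝ} (hν : 0 ≤ ν) {c : EuclideanSpace ℝ (Fin 3)}
    {S : Finset (Fin 3 → ℤ)} (hS : ∀ k ∈ S, -k ∈ S) (h0 : (0 : Fin 3 → ℤ) ∉ S)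
    {C : (Fin 3 → ℤ) → EuclideanSpace ℂ (Fin 3)} (hC : IsConjSymm C) {k₀ : Fin 3 → ℤ}
    {n : (Fin 3 → ℤ) → ℤ} (hn : ∀ k ∈ S, k = n k • k₀) (hck : freqDot c k₀ ≠ 0) :
    ν * (eGradNormSq (sweptState ν c S C)).toReal ≤
      ν * (freqNormSq k₀ * (∫ x, ‖realTrigPoly S C x‖ ^ 2) / (freqDot c k₀) ^ 2) := by
  rw [dissipation_sweptState ν c hS h0 hC, integral_norm_sq_realTrigPoly hS hC]
  have hpos : 0 < freqDot c k₀ ^ 2 := by positivity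
  calc 4 * Real.pi ^ 2 * ν * ∑ k ∈ S, freqNormSq k * ‖C k‖ ^ 2 / ‖sweptSymbol ν c k‖ ^ 2
      = ∑ k ∈ S, ν * (4 * Real.pi ^ 2 * freqNormSq k * ‖C k‖ ^ 2 / ‖sweptSymbol ν c k‖ ^ 2) := by
        rw [Finset.mul_sum]
        exact Finset.sum_congr rfl fun k _ => by ring
    _ ≤ ∑ k ∈ S, ν * (freqNormSq k₀ * ‖C k‖ ^ 2 / freqDot c k₀ ^ 2) :=
        Finset.sum_le_sum fun k hk => mul_le_mul_of_nonneg_left (by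
          have h1 := (norm_sq_sweptSymbol_ge (ν := ν) (c := c) h0 hn hk).1
          have h2 := (norm_sq_sweptSymbol_ge (ν := ν) (c := c) h0 hn hk).2
          have hσ : 0 < ‖sweptSymbol ν c k‖ ^ 2 := lt_of_lt_of_le (by positivity) h1
          rw [div_le_div_iff₀ hσ hpos]
          nlinarith [mul_le_mul_of_nonneg_right h2 (sq_nonneg ‖C k‖)]) hν
    _ = ν * (freqNormSq k₀ * (∑ k ∈ S, ‖C k‖ ^ 2) / freqDot c k₀ ^ 2) := by
        rw [← Finset.mul_sum]
        congr 1
        rw [Finset.mul_sum, Finset.sum_div]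

/-- **Momentum of a swept state**: `∫ U_{ν,c} = c`. [folklore] -/
theorem integral_sweptState (ν : ℝ) (c : EuclideanSpace ℝ (Fin 3)) {S : Finset (Fin 3 → ℤ)}
    (h0 : (0 : Fin 3 → ℤ) ∉ S) (C : (Fin 3 → ℤ) → EuclideanSpace ℂ (Fin 3)) :
    ∫ x, sweptState ν c S C x = c := by
  rw [sweptState]
  simp_rw [realTrigPoly_apply_eq_sum]
  have hI : ∀ k,
      Integrable (fun x : UnitAddTorus (Fin 3) => mFourier k x • sweptCoeff ν c C k) volume :=
    fun k => ((mFourier k).continuous.smul continuous_const).integrable_unitAddTorus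
  have hint : ∀ k ∈ insert (0 : Fin 3 → ℤ) S,
      Integrable (fun x : UnitAddTorus (Fin 3) =>
        EuclideanSpace.realPart (mFourier k x • sweptCoeff ν c C k)) volume :=
    fun k _ => (EuclideanSpace.realPart :
      EuclideanSpace ℂ (Fin 3) →L[ℝ] EuclideanSpace ℝ (Fin 3)).integrable_comp (hI k)
  rw [integral_finsetSum _ hint, Finset.sum_insert h0,
    Finset.sum_eq_zero fun k hk => ?_, add_zero]
  · rw [(EuclideanSpace.realPart :
        EuclideanSpace ℂ (Fin 3) →L[ℝ] EuclideanSpace ℝ (Fin 3)).integral_comp_comm (hI 0),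
      integral_smul_const, integral_mFourier, if_pos rfl, one_smul, sweptCoeff_zero,
      EuclideanSpace.realPart_complexify]
  · rw [(EuclideanSpace.realPart :
        EuclideanSpace ℂ (Fin 3) →L[ℝ] EuclideanSpace ℝ (Fin 3)).integral_comp_comm (hI k),
      integral_smul_const, integral_mFourier, if_neg (fun h : k = 0 => h0 (h ▸ hk)), zero_smul,
      map_zero]

/-! ### The separating Leray–Hopf families -/

/-- **Swept screening for the whole unidirectional class.** Let `f = realTrigPoly S C` be any
unidirectional (`S ⊂ ℤk₀ ∖ 0`, `S = -S`), real, divergence-free trigonometric-polynomial force and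
`c` any momentum with `c·k₀ ≠ 0`. Then `f` is smooth, divergence free and mean zero, and for
`νⱼ = 1/(j+1) → 0` the swept states `U_{νⱼ,c}` are global Leray–Hopf solutions of `NS_{νⱼ}(f)` of
momentum `c` whose mean energies are bounded by `‖c‖² + ‖f‖₂²/(4π²(c·k₀)²)` uniformly in `j`
while their mean dissipation rates are `≤ νⱼ |k₀|²‖f‖₂²/(c·k₀)² → 0`: every clause of
`Literature.Turb.ZerothLaw` except the dissipation floor, on every non-resonant momentum leaf.
[folklore] -/
theorem exists_sweptFamily {S : Finset (Fin 3 → ℤ)} (hS : ∀ k ∈ S, -k ∈ S)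
    (h0 : (0 : Fin 3 → ℤ) ∉ S) {C : (Fin 3 → ℤ) → EuclideanSpace ℂ (Fin 3)} (hC : IsConjSymm C)
    (hT : IsTransversal S C) (hC0 : C 0 = 0) {k₀ : Fin 3 → ℤ} {n : (Fin 3 → ℤ) → ℤ}
    (hn : ∀ k ∈ S, k = n k • k₀) {c : EuclideanSpace ℝ (Fin 3)} (hck : freqDot c k₀ ≠ 0) :
    IsSmooth (realTrigPoly S C) ∧ IsDivFree (realTrigPoly S C) ∧ HasZeroMean (realTrigPoly S C) ∧
      ∃ (ν : ℕ → ℝ) (u : ℕ → ℝ → UnitAddTorus (Fin 3) → EuclideanSpace ℝ (Fin 3)),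
        (∀ j, 0 < ν j) ∧ Tendsto ν atTop (𝓝 0) ∧
        (∀ j, Torus.IsGlobalLerayHopf (ν j) (fun _ => realTrigPoly S C) (u j 0) (u j)) ∧
        (∀ j, meanEnergy (u j) ≤
          ‖c‖ ^ 2 + (∫ x, ‖realTrigPoly S C x‖ ^ 2) / (2 * Real.pi * freqDot c k₀) ^ 2) ∧
        (∀ j, meanDissipation (ν j) (u j) ≤
          ν j * (freqNormSq k₀ * (∫ x, ‖realTrigPoly S C x‖ ^ 2) / (freqDot c k₀) ^ 2)) ∧
        Tendsto (fun j => meanDissipation (ν j) (u j)) atTop (𝓝 0) ∧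
        (∀ j t, ∫ x, u j t x = c) := by
  have hν : ∀ j : ℕ, (0 : ℝ) < 1 / ((j : ℝ) + 1) := fun j => by positivity
  have hσ : ∀ ν, ∀ k ∈ S, sweptSymbol ν c k ≠ 0 := fun ν k hk =>
    sweptSymbol_ne_zero (Or.inr (by
      rw [hn k hk, freqDot_zsmul]
      have : n k ≠ 0 := fun h => h0 (by rw [hn k hk, h, zero_smul] at hk; exact hk)
      exact mul_ne_zero (by exact_mod_cast this) hck))
  set K : ℝ := freqNormSq k₀ * (∫ x, ‖realTrigPoly S C x‖ ^ 2) / (freqDot c k₀) ^ 2 with hK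
  have hE : ∀ ν, meanEnergy (fun _ : ℝ => sweptState ν c S C) = ∫ x, ‖sweptState ν c S C x‖ ^ 2 :=
    fun ν => by rw [meanEnergy_eq_longTimeAvgSup]; exact longTimeAvgSup_of_eq_const fun _ _ => rfl
  have hD : ∀ ν, meanDissipation ν (fun _ : ℝ => sweptState ν c S C) =
      ν * (eGradNormSq (sweptState ν c S C)).toReal := fun ν => by
    unfold meanDissipation; exact longTimeAvgSup_of_eq_const fun _ _ => rfl
  refine ⟨isSmooth_realTrigPoly S C, isDivFree_realTrigPoly hT,
    hasZeroMean_realTrigPoly_of_zero_not_mem h0 C, fun j => 1 / ((j : ℝ) + 1),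
    fun j _ => sweptState (1 / ((j : ℝ) + 1)) c S C, hν, tendsto_one_div_add_atTop_nhds_zero_nat,
    fun j => IsClassicalNSSolutionOn.isGlobalLerayHopf
      (isSteadyNSState_sweptState h0 hn hT hC0 (hσ _)),
    fun j => ?_, fun j => ?_, ?_, fun j _ => integral_sweptState _ c h0 C⟩
  · rw [hE]; exact integral_norm_sq_sweptState_le _ hS h0 hC hn hck
  · rw [hD]; exact dissipation_sweptState_le (hν j).le hS h0 hC hn hck
  · have hK0 : Tendsto (fun j : ℕ => 1 / ((j : ℝ) + 1) * K) atTop (𝓝 0) := by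
      simpa using tendsto_one_div_add_atTop_nhds_zero_nat.mul_const K
    refine squeeze_zero (fun j => ?_) (fun j => ?_) hK0
    · rw [hD]; exact mul_nonneg (hν j).le ENNReal.toReal_nonneg
    · rw [hD]; exact dissipation_sweptState_le (hν j).le hS h0 hC hn hck

/-- The hypotheses of `exists_sweptFamily` are met by the Kolmogorov force of
`SoloBlindDriftStates` (`k₀ = e₃`, modes `±e₃`, `n(k) = k₃`) at every momentum `c` with `c₃ ≠ 0`:
the unidirectional class is non-empty and contains the drifted Kolmogorov family. [folklore] -/
theorem exists_sweptFamily_kolForce {c : EuclideanSpace ℝ (Fin 3)} (hc : c 2 ≠ 0) :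
    ∃ (ν : ℕ → ℝ) (u : ℕ → ℝ → UnitAddTorus (Fin 3) → EuclideanSpace ℝ (Fin 3)),
      (∀ j, 0 < ν j) ∧ Tendsto ν atTop (𝓝 0) ∧
      (∀ j, Torus.IsGlobalLerayHopf (ν j) (fun _ => kolForce) (u j 0) (u j)) ∧
      (∀ j, meanEnergy (u j) ≤
        ‖c‖ ^ 2 + (∫ x, ‖kolForce x‖ ^ 2) / (2 * Real.pi * freqDot c kolFreq) ^ 2) ∧
      Tendsto (fun j => meanDissipation (ν j) (u j)) atTop (𝓝 0) ∧
      (∀ j t, ∫ x, u j t x = c) := by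
  have hn : ∀ k ∈ kolModes, k = k 2 • kolFreq := fun k hk => by
    rcases mem_kolModes_iff.1 hk with rfl | rfl <;> decide
  have hck : freqDot c kolFreq ≠ 0 := by
    simpa [freqDot, kolFreq, Fin.sum_univ_three] using hc
  obtain ⟨-, -, -, ν, u, hν, hν0, hlh, hE, -, hD, hm⟩ :=
    exists_sweptFamily kolModes_symm zero_not_mem_kolModes isConjSymm_kolForceCoeff
      isTransversal_kolForceCoeff kolForceCoeff_zero hn hck
  exact ⟨ν, u, hν, hν0, fun j => by simpa only [kolForce] using hlh j,
    fun j => by simpa only [kolForce] using hE j, hD, hm⟩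

end Summit.AnomalousDissipation.AnomalousDissipation.Theorems

end
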